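import Literature.Claims.NS.ClayVariants
import Literature.Analysis.FluidPDE.BeltramiFlows
import Literature.Analysis.FluidPDE.PeriodicGalileanNonuniqueness
import HarnessLib

/-!
# Claim skeleton: Zhirkin (2016), «Existence and properties of the Navier–Stokes equations»
# (Cogent Mathematics 3 (2016) 1190308 = arXiv:1608.07696v1)

Cell `ns-claims` (D-0090 NS-CLAIMS SWEEP), claim C53, typist `ns-claims-typist-3` (g2).
UNREFEREED/DISPUTED CLAIM under adjudication — NOTHING in this file asserts a step: every `Step…`
declaration is a `Prop`; the `theorem`s are unfolding lemmas, two TRUE steps discharged from the tree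
(`step1_holds`, `step6_holds`) and the kernel record of what the printed steps DO compose to
(`clayA_of_step3_step6`, `clayA_of_step4_step5` — they yield Clay (A), the negation of the first conjunct
of the printed conclusion). Refutations go summit-side (`Theorems/SoloRefuteZhirkin2016.lean`).

Version of record (pinned by ns-claims-lit-2, `pub/ns-claims/sources/Zhirkin2016/LOCATORS.md`):
A. V. Zhirkin, Cogent Mathematics 3 (2016) 1190308, doi:10.1080/23311835.2016.1190308 = arXiv
1608.07696 v1 (only version; the author manuscript, 22 pp.) [Zhirkin2016]. LOCATORS ARE arXiv-PDF PAGES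
and printed equation numbers; formulas read on the renders `renders/p004–p008.png, p020–p021.png`
(the Word text layer drops them). §3 of the paper (pp.8–20, «Alternative») develops the author's
MODIFIED equations (non-solenoidal potential part, resonance, MHD dynamo) — not Navier–Stokes, not typed.

## Claimed statement (as printed, §4 «Summary» p.20–21)

«It is possible to give a certain answer to the Clay Mathematics Institute's question. There exist
no smooth functions p(t,r), v(t,r) on [0,∞)×R³ that satisfy the claims (A) or (B). For η > 0, the
smooth solutions of the Navier-Stokes equations exist only in space of two variables. We obtained the
general solution of the mass continuity equation and studied it for the condition η > 0. The result
is that there exists no smooth, divergence-free vector field v₀(r) on R³ satisfying (C) or (D).» …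
«There are no conditions for smooth incompressible viscous velocities v(0,r) that ensure, in the
absence of external input of energy, that the solutions of the Navier-Stokes equations exist for all
positive time in three dimensions and are smooth.» p.21: «Under the conditions (A) and (B) the
divergence-free solutions can be obtained only if the Navier-Stokes equation system takes the
two-dimensional and linear form.» Abstract p.1: «The analysis shows that there exist no viscous
solutions of the Navier-Stokes equations in three dimensions. The reason is the insufficient
capability of the divergence-free velocity field.» ((A)–(D) are transcribed from [Fefferman] in §2.1
pp.3–4, with (7) restated to include the pressure — author's Note p.3.)

TYPED: `ClaimedTheorem` := the §4 conjunction read over the Clay schema — (A) fails ∧ (B) fails ∧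
(C) fails ∧ (D) fails (`¬ clayR3.Regularity ∧ ¬ clayPeriodic.Regularity ∧ ¬ clayR3.Breakdown ∧
¬ clayPeriodic.Breakdown`; «no smooth functions … satisfy the claims (A) or (B)» = the solutions
(A)/(B) ask for do not exist; «no smooth, divergence-free vector field v₀ … satisfying (C) or (D)» =
the witness data (C)/(D) ask for do not exist). `ClaimedMechanism` := «the smooth solutions of the
Navier-Stokes equations exist only in space of two variables» (every smooth unforced solution on
`ℝ³ × [0,∞)` has, at each time, a velocity invariant along some direction).

## Clay delta (reference `ClayVariants.lean`)

No single nearest statement: the printed conclusion denies BOTH members of each Clay dichotomy. The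
tree PROVES `ClayVariants.clayR3_regularity_or_exists_breakdownAt` ((A) ∨ breakdown at some ν, hence
(A) ∨ (C) by `clayR3_breakdownAt_iff`) and `navierStokesExistenceSmoothPeriodic_or_exists_breakdownAt`
— so `ClaimedTheorem` is refutable AS A STATEMENT by pure logic over the Clay schema (the refuter's
one-liner `not_ClaimedTheorem`; this file only projects: `claimed_denies_dichotomy`). Setting deltas
(CARD §3): Δ1 the argument is run on a compact domain `G` with no-slip boundary (4) and conditions
(13)–(16) §2.2 p.4, passing to ℝ³ «by the limit of the Fourier series» p.5; Δ2 «=» NS in §2 (§3 =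
modified equations); (7) restated with a pressure condition (p.3 Note). Δ8: the negation structure is
the locus of the LOGIC failure recorded below.

## Steps, in the dependency order of the printed argument (§2.3 → §2.4 → §4; paper item · page · flag)

* Step 1 = `Step1_vectorPoisson` — §2.3 (19)–(30) p.6: for a divergence-free field `v = curl H`,
  `Δv = −∇×j` with `j = curl v` ((29); «the general solution of the system (22) is reduced to the
  general solution of Equation (29)») — true (vector identity; `step1_holds`, tree
  `laplacian_eq_neg_curl_curl`).
* Step 2 = `Step2_harmonicTwoVariables` — §2.3 p.7 ¶1–2: «The harmonic functions possess the property
  of completeness only for two variables. For the third variable it is impossible to construct the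
  complete system of functions. … Φ(t,r) ~ exp(k·r) for k² = 0 … the value of one wave vector
  projection always depends on two others. … The complete system can be constructed only for the
  functions of two spatial variables.» Typed (the potential part `v_POT = ∇Φ`, `ΔΦ = 0`, (24)–(27)):
  every smooth harmonic function on ℝ³ is a function of two spatial variables in a suitable Cartesian
  frame, i.e. invariant along some direction — known-false pattern (`Φ = x₁x₂x₃`).
* Step 3 = `Step3_solenoidalTwoVariables` — §2.3 (33)–(38) p.7 + p.8 ¶1: «If one axis of the Cartesian
  system of coordinates is directed in parallel to the vector v(t,r) the solution becomes the function
  of only two spatial variables. The transformation to an arbitrary Cartesian system of coordinates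
  and a curvilinear coordinate system leads to the result that there are only two independent spatial
  variables.» Typed: every smooth divergence-free field on ℝ³ is invariant along some direction —
  known-false pattern (the ABC field `Literature.Analysis.FluidPDE.abc 1 1 1`: smooth, divergence
  free, invariant along no direction). THE DECISIVE STEP («the insufficient capability of the
  divergence-free velocity field», abstract).
* Step 4 = `Step4_nonlinearVanishes` — §2.4 (39) p.8: «the nonlinear term is equal to 0 in the Cauchy
  momentum equation if there are no external sources of a fluid motion in R³ … (v·∇)v = (v_SOL·∇)v_SOL
  ~ (k'·v_SOL(t,k))·v_SOL(t,k') = 0 because the condition k ⊥ v is performed for any k» — typed: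
  `(v·∇)v ≡ 0` for every smooth divergence-free `v` on ℝ³ — known-false pattern (`abc 1 1 1`:
  `(v·∇)v = ∇(|v|²/2) ≢ 0`, tree `convect_abc`).
* Step 5 = `Step5_linearGlobal` — §2.4 (40)–(42) p.8: «Equation (18) is a linear one: ρ∂v_SOL/∂t =
  ηΔv_SOL + f_ex (41) … We obtain the global solution of the problem for f_ex ≡ 0 if we take the
  improper integral of the function (42) over the continuous spectra … and satisfy the initial
  condition. The solution is a smooth function at any time moment (0 ≤ t < ∞).» Typed as the printed
  inference: IF the nonlinear term vanishes for every divergence-free field (Step 4) THEN every Clay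
  datum has a global smooth bounded-energy solution (heat flow, `p ≡ 0`) — i.e. `Step 4 → (A)`;
  true (classical heat semigroup), not discharged here.
* Step 6 = `Step6_invariantDecayZero` — implicit between §2.3 p.8 and §4 p.20 («there exists no smooth,
  divergence-free vector field v₀(r) on R³ satisfying (C) or (D)», i.e. satisfying the decay (5)/(13)):
  a field invariant along a non-zero direction and rapidly decaying (Clay (4)) vanishes identically —
  true (`step6_holds`).
* `ClaimedMechanism` — §4 p.20 «For η > 0, the smooth solutions of the Navier-Stokes equations exist
  only in space of two variables» — recorded (refutable by the viscous ABC flow,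
  `isClassicalNSSolutionOn_abc`); not a step of the chain.
Ordered index (TYPING-HYGIENE 11): 1 → 2 → 3 → 4 → 5 → 6 → §4. Not typed: §2.2 pp.4–5 (series
«idea of proof», no inference used downstream except «as for the system of two linear equations» =
Step 5), (31)–(32) (cylindrical/spherical restatements of Step 2), §3 (modified equations), (17)–(18)
(pressure Poisson / projection — classical).

## COMPOSITION — FAILS (BREAKS AT LOGIC), with the kernel record of what the steps DO give

`Composes : Prop := Step1 → … → Step6 → ClaimedTheorem` is a `def`, NOT a theorem: the printed steps
entail the OPPOSITE of the first conjunct. (i) Steps 3 + 6: every Clay datum (smooth, divergence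
free, rapidly decaying) is invariant along a direction, hence `≡ 0`, and the zero datum has the rest
solution — `clayA_of_step3_step6 : Step3 → Step6 → clayR3.Regularity` PROVED; (ii) Steps 4 + 5: the
nonlinear term vanishes and the linear problem is globally solvable — `clayA_of_step4_step5 : Step4 →
Step5 → clayR3.Regularity` PROVED (modus ponens). The §4 sentence «There exist no smooth functions …
that satisfy the claims (A)» is the missing/contrary implication — LOGIC locator: §4 p.20 ¶1, from
«smooth solutions … exist only in space of two variables» to «no smooth functions satisfy (A) or (B)».
Independently, `ClaimedTheorem` contradicts the tree's dichotomy (A) ∨ (C) (`claimed_denies_dichotomy`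
+ `ClayVariants.clayR3_regularity_or_exists_breakdownAt`).

WHAT THIS IS NOT: not a claim about NS regularity or blow-up; not a claim about any author beyond the
typed locator.
-/

noncomputable section

open Set Function Filter MeasureTheory
open scoped Topology ENNReal NNReal ContDiff Laplacian

namespace Literature.Claims.NS.Zhirkin2016

open Literature.Analysis.FluidPDE

/-! ## Vocabulary -/

/-- «Function of only two spatial variables (in a suitable Cartesian frame)» / «only two independent
spatial variables» (p.7–8): the field is invariant under translation along some non-zero direction
`e` (the third axis of the frame). [cite: Zhirkin2016, §2.3 p.7–8] -/
def IsTwoVariable {F : Type*} (w : EuclideanSpace ℝ (Fin 3) → F) : Prop :=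
  ∃ e : EuclideanSpace ℝ (Fin 3), e ≠ 0 ∧ ∀ (x : EuclideanSpace ℝ (Fin 3)) (s : ℝ), w (x + s • e) = w x

/-! ## The claimed statements (§4 p.20–21) -/

/-- **§4 «Summary», p.20 (the claimed answer to the Clay question), over the Clay schema**: «There
exist no smooth functions p(t,r), v(t,r) on [0,∞)×R³ that satisfy the claims (A) or (B)» ((A) and
(B) fail: the solutions they ask for do not exist) ∧ «there exists no smooth, divergence-free vector
field v₀(r) on R³ satisfying (C) or (D)» ((C) and (D) fail: no witness datum exists). (A)–(D) as
transcribed in §2.1 pp.3–4 from Fefferman; cited here by their `ClayVariants` schema names (printed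
(D)). [cite: Zhirkin2016, §4 p.20 ¶1–2] -/
def ClaimedTheorem : Prop :=
  ¬ ClayVariants.clayR3.Regularity ∧ ¬ ClayVariants.clayPeriodic.Regularity ∧
    ¬ ClayVariants.clayR3.Breakdown ∧ ¬ ClayVariants.clayPeriodic.Breakdown

/-- **§4 p.20: «For η > 0, the smooth solutions of the Navier-Stokes equations exist only in space of
two variables»** (also p.21 «… only if the Navier-Stokes equation system takes the two-dimensional and
linear form»): every smooth unforced classical solution on `ℝ³ × [0,∞)` has, at each time, a
two-variable velocity. Recorded; not a step of the chain (refutable by any genuinely three-dimensional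
smooth solution, e.g. the viscous ABC flow). [cite: Zhirkin2016, §4 p.20 ¶1 and p.21 ¶1] -/
def ClaimedMechanism : Prop :=
  ∀ ν : ℝ, 0 < ν →
    ∀ (u : ℝ → EuclideanSpace ℝ (Fin 3) → EuclideanSpace ℝ (Fin 3)) (p : ℝ → EuclideanSpace ℝ (Fin 3) → ℝ),
      IsClassicalNSSolutionOn (Ici 0) ν 0 u p → ∀ t : ℝ, 0 ≤ t → IsTwoVariable (u t)

/-- The claimed conjunction denies both members of the whole-space Clay dichotomy (projection; the
dichotomy `clayR3.Regularity ∨ ∃ ν > 0, clayR3.BreakdownAt ν` is the tree's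
`ClayVariants.clayR3_regularity_or_exists_breakdownAt`, and `clayR3.BreakdownAt ν ↔ (C)` is
`ClayVariants.clayR3_breakdownAt_iff`). [cite: Zhirkin2016, §4 p.20 ¶1–2] -/
theorem claimed_denies_dichotomy (h : ClaimedTheorem) :
    ¬ ClayVariants.clayR3.Regularity ∧ ¬ ClayVariants.clayR3.Breakdown :=
  ⟨h.1, h.2.2.1⟩

/-! ## The steps -/

/-- **Step 1 — §2.3 (19)–(30) p.6**: «curl(curl(H(t,r))) = j(t,r) ⇒ ∇(div(H)) − ΔH = j (28) … Using
the correlations curl(∇(div H)) = 0 and curl(ΔH) = Δ(curl H) = Δv_SOL, we obtain the Poisson equation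
for the velocity Δv_SOL(t,r) = −∇×j(t,r) (29)», with `j = curl v` (20): for a smooth divergence-free
field, `Δv = −curl curl v`. True (`step1_holds`). [cite: Zhirkin2016, §2.3 eqs. (19)–(30) p.6] -/
def Step1_vectorPoisson : Prop :=
  ∀ v : EuclideanSpace ℝ (Fin 3) → EuclideanSpace ℝ (Fin 3), ContDiff ℝ ∞ v → NSWave0.IsDivFree v →
    ∀ x, (Δ v) x = -curl (curl v) x

/-- **Step 2 — §2.3 p.7 ¶1–2 (the potential part `v_POT = ∇Φ`, `ΔΦ = 0`, (24)–(27) p.6)**: «The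
harmonic functions possess the property of completeness only for two variables. For the third
variable it is impossible to construct the complete system of functions. … We investigate the solution
which is looking as Φ(t,r) ~ exp(k·r) for k² = 0, where k is a complex-valued vector. In this solution
the value of one wave vector projection always depends on two others. The correlation between
projections does not allow constructing the orthonormal basis for one of the three spatial
coordinates. The complete system can be constructed only for the functions of two spatial variables.»
Typed: every smooth harmonic function on ℝ³ is two-variable. Typist's flag: known-false pattern
(`Φ(x) = x₁x₂x₃` is harmonic and invariant along no direction). [cite: Zhirkin2016, §2.3 p.7 ¶1–2 with (24)–(27) p.6] -/
def Step2_harmonicTwoVariables : Prop :=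
  ∀ Φ : EuclideanSpace ℝ (Fin 3) → ℝ, ContDiff ℝ ∞ Φ → (∀ x, (Δ Φ) x = 0) → IsTwoVariable Φ

/-- **Step 3 — §2.3 (33)–(38) p.7 + p.8 ¶1, THE DECISIVE STEP**: «The alternative solution is k ⊥
v(t,r) where k is a complex-valued vector. It is valid for the velocity v_SOL(t,r) satisfying Equation
(29). In this case, there exists correlation defined by the necessity to choose the vector k direction
that is perpendicular to the vector v(t,r). For the problem solving in the Cartesian or curvilinear
coordinates, this correlation reduces the number of uncertain eigenvalues as it has occurred for the
Laplace equation. If one axis of the Cartesian system of coordinates is directed in parallel to the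
vector v(t,r) the solution becomes the function of only two spatial variables. The transformation to
an arbitrary Cartesian system of coordinates and a curvilinear coordinate system leads to the result
that there are only two independent spatial variables.» Typed: every smooth divergence-free field on
ℝ³ is two-variable (invariant along some non-zero direction). Typist's flag: known-false pattern
(`k ⊥ a` removes one AMPLITUDE component per mode, not a spatial variable; the ABC field `abc 1 1 1`
is smooth, divergence free and invariant along no direction). [cite: Zhirkin2016, §2.3 eqs. (33)–(38) p.7 and p.8 ¶1] -/
def Step3_solenoidalTwoVariables : Prop :=
  ∀ v : EuclideanSpace ℝ (Fin 3) → EuclideanSpace ℝ (Fin 3), ContDiff ℝ ∞ v → NSWave0.IsDivFree v →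
    IsTwoVariable v

/-- **Step 4 — §2.4 (39) p.8**: «Under the condition η > 0 the three-dimensional Navier-Stokes
equations are reduced to a two-dimensional one. Besides this, the nonlinear term is equal to 0 in the
Cauchy momentum equation if there are no external sources of a fluid motion in R³. Using expression
(33), we have (v·∇)v = (v_SOL·∇)v_SOL ~ (k'·v_SOL(t,k))·v_SOL(t,k') = 0 (39) because the condition
k ⊥ v is performed for any k in v_SOL(t,k).» Typed: `(v·∇)v ≡ 0` for every smooth divergence-free
field on ℝ³ (`convect v v x = Dv(x)(v x)`). Typist's flag: known-false pattern (cross terms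
`k'·v(k) ≠ 0` between different modes; `abc 1 1 1` has `(v·∇)v = ∇(|v|²/2) ≢ 0`).
[cite: Zhirkin2016, §2.4 eq. (39) p.8] -/
def Step4_nonlinearVanishes : Prop :=
  ∀ v : EuclideanSpace ℝ (Fin 3) → EuclideanSpace ℝ (Fin 3), ContDiff ℝ ∞ v → NSWave0.IsDivFree v →
    ∀ x, convect v v x = 0

/-- **Step 5 — §2.4 (40)–(42) p.8**: «It means that there is no a term with velocity in Equation (17):
Δp = div f_ex (40), and Equation (18) is a linear one: ρ∂v_SOL/∂t = ηΔv_SOL + f_ex (41). As a result,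
we obtain the eigensolution of the Navier-Stokes equations … (42) … We obtain the global solution of
the problem for f_ex ≡ 0 if we take the improper integral of the function (42) over the continuous
spectra … and satisfy the initial condition. The solution is a smooth function at any time moment
(0 ≤ t < ∞).» Typed as the printed inference: if the nonlinear term vanishes identically on
divergence-free fields (Step 4), every Clay datum has a global smooth bounded-energy unforced solution
— Clay (A) in the schema (`p ≡ 0`, heat flow). Typist's flag: true (heat semigroup), not discharged
here. [cite: Zhirkin2016, §2.4 eqs. (40)–(42) p.8] -/
def Step5_linearGlobal : Prop :=
  Step4_nonlinearVanishes → ClayVariants.clayR3.Regularity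

/-- **Step 6 — implicit between §2.3 p.8 and §4 p.20** («there exists no smooth, divergence-free vector
field v₀(r) on R³ satisfying (C) or (D)» — i.e. satisfying the decay (5) = (13) p.4 «|∂ᵅv₀(r)| ≤
C_{α,K}(1+|r|)^{−K} … for any α and K» — once every divergence-free field is two-variable): a
two-variable field with Clay's rapid spatial decay (4)/(5) vanishes identically. True (`step6_holds`).
[cite: Zhirkin2016, §4 p.20 ¶2 with (13) p.4] -/
def Step6_invariantDecayZero : Prop :=
  ∀ v : EuclideanSpace ℝ (Fin 3) → EuclideanSpace ℝ (Fin 3), IsTwoVariable v → HasRapidSpatialDecay v →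
    v = 0

/-! ## Composition: the LOGIC gap (a `Prop`) and the kernel record of what the steps give -/

/-- **The shape of the §4 inference — a `Prop`, NOT a theorem (BREAKS AT LOGIC).** The printed steps
entail Clay (A) (`clayA_of_step3_step6`, `clayA_of_step4_step5`), i.e. the NEGATION of the first
conjunct of `ClaimedTheorem`; no printed sentence supplies «steps ⇒ no smooth functions satisfy (A) or
(B)». -- LOGIC: missing (indeed contrary) implication, §4 p.20 ¶1: from «the smooth solutions … exist
-- only in space of two variables» to «There exist no smooth functions … that satisfy the claims (A)
-- or (B)». [cite: Zhirkin2016, §4 p.20 ¶1–2] -/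
def Composes : Prop :=
  Step1_vectorPoisson → Step2_harmonicTwoVariables → Step3_solenoidalTwoVariables →
    Step4_nonlinearVanishes → Step5_linearGlobal → Step6_invariantDecayZero → ClaimedTheorem

/-- The rest state solves Clay (A)'s Cauchy problem for the zero datum (tree
`isNavierStokesSolution_zero`; bounded energy `0`). [cite: FeffermanClay2006, (A) with (1)–(3), (6), (7), CMI offprint p. 2] -/
theorem clayR3_solvable_zero (ν : ℝ) : ClayVariants.clayR3.Solvable ν 0 0 := by
  obtain ⟨hns, hsu, hsp⟩ :=
    isNavierStokesSolution_zero (E := EuclideanSpace ℝ (Fin 3)) ν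
  refine ⟨0, 0, hsu, hsp, hns, ?_⟩
  show HasBoundedEnergy (0 : ℝ → EuclideanSpace ℝ (Fin 3) → EuclideanSpace ℝ (Fin 3))
  exact ⟨0, ENNReal.zero_lt_top, fun t _ => by simp⟩

/-- **KERNEL RECORD (i): Steps 3 + 6 give Clay (A)** — every Clay datum (smooth, divergence free,
rapidly decaying (4)) is two-variable (Step 3), hence `≡ 0` (Step 6), and the zero datum has the rest
solution; this is the OPPOSITE of the first conjunct of `ClaimedTheorem`. Pure logic + the rest
solution. [cite: Zhirkin2016, §2.3 p.7–8 with §4 p.20] -/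
theorem clayA_of_step3_step6 (h3 : Step3_solenoidalTwoVariables) (h6 : Step6_invariantDecayZero) :
    ClayVariants.clayR3.Regularity := by
  intro ν _ u₀ hu₀ hdiv hdec
  have h0 : u₀ = 0 := h6 u₀ (h3 u₀ hu₀ hdiv) hdec
  subst h0
  exact clayR3_solvable_zero ν

/-- **KERNEL RECORD (ii): Steps 4 + 5 give Clay (A)** (modus ponens on the printed inference (39) ⇒
(40)–(42)). [cite: Zhirkin2016, §2.4 eqs. (39)–(42) p.8] -/
theorem clayA_of_step4_step5 (h4 : Step4_nonlinearVanishes) (h5 : Step5_linearGlobal) :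
    ClayVariants.clayR3.Regularity :=
  h5 h4

/-! ## Discharged TRUE steps -/

/-- **Step 1 holds**: `Δv = −curl curl v` for smooth divergence-free `v` (tree
`laplacian_eq_neg_curl_curl`). [cite: Zhirkin2016, §2.3 eq. (29) p.6] -/
theorem step1_holds : Step1_vectorPoisson := by
  intro v hv hdiv x
  exact laplacian_eq_neg_curl_curl (hv.of_le (by norm_cast)) (fun y => hdiv y) x

/-- **Step 6 holds**: a field invariant along a non-zero direction and rapidly decaying vanishes
(the decay (4) at order 0, `K = 1`, gives `(1 + ‖y‖)‖v y‖ ≤ C`; along the invariant direction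
`‖x + s•e‖ → ∞`). [cite: Zhirkin2016, §4 p.20 ¶2 with (13) p.4] -/
theorem step6_holds : Step6_invariantDecayZero := by
  intro v ⟨e, he, hinv⟩ hdec
  obtain ⟨C, hC⟩ := hdec 0 1
  have hC' : ∀ y, (1 + ‖y‖) * ‖v y‖ ≤ C := fun y => by
    simpa [norm_iteratedFDeriv_zero] using hC y
  funext x
  -- `‖v x‖ = ‖v (x + s • e)‖ ≤ C / (1 + ‖x + s • e‖)` for every `s`; let `s → ∞`.
  by_contra hx
  have hvx : 0 < ‖v x‖ := norm_pos_iff.mpr hx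
  have he' : 0 < ‖e‖ := norm_pos_iff.mpr he
  -- choose `s` with `‖x + s • e‖ ≥ s‖e‖ − ‖x‖ > C / ‖v x‖`
  set s : ℝ := (C / ‖v x‖ + ‖x‖ + 1) / ‖e‖ with hs
  have hse : s * ‖e‖ = C / ‖v x‖ + ‖x‖ + 1 := by
    rw [hs]; field_simp
  have hnorm : s * ‖e‖ - ‖x‖ ≤ ‖x + s • e‖ := by
    have h1 : ‖s • e‖ ≤ ‖x + s • e‖ + ‖x‖ := by
      calc ‖s • e‖ = ‖(x + s • e) - x‖ := by simp
        _ ≤ ‖x + s • e‖ + ‖x‖ := norm_sub_le _ _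
    have hC0 : 0 ≤ C := le_trans (by positivity) (hC' x)
    have hspos : 0 ≤ s := by
      rw [hs]
      exact div_nonneg (add_nonneg (add_nonneg (div_nonneg hC0 (norm_nonneg _)) (norm_nonneg _))
        zero_le_one) (norm_nonneg _)
    rw [norm_smul, Real.norm_eq_abs, abs_of_nonneg hspos] at h1
    linarith
  have hkey := hC' (x + s • e)
  rw [hinv x s] at hkey
  -- `(1 + ‖x + s•e‖) ‖v x‖ ≤ C` but `1 + ‖x + s•e‖ > C / ‖v x‖ + 1`
  have hgt : C < (1 + ‖x + s • e‖) * ‖v x‖ := by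
    have h2 : C / ‖v x‖ + 1 ≤ ‖x + s • e‖ := by linarith
    have h3 : C / ‖v x‖ * ‖v x‖ = C := div_mul_cancel₀ C hvx.ne'
    nlinarith
  exact absurd hkey (not_le.mpr hgt)

/-- Step 4 is false: for the ABC field `v = abc 1 1 1` (smooth, divergence free) the first
component of `((v·∇)v)(0)` is `1` (cross terms between different Fourier modes). Private twin of
the summit-side `…Theorems.Zhirkin2016.not_Step4_nonlinearVanishes` (refuter-7), which a Literature
file cannot import. [cite: Zhirkin2016, §2.4 eq. (39) p.8] -/
private theorem not_step4 : ¬ Step4_nonlinearVanishes := by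
  intro h4
  have h := h4 (ABC.abc 1 1 1) (ABC.contDiff_abc 1 1 1) (fun x => ABC.isDivFree_abc 1 1 1 x) 0
  have hv : ABC.abc 1 1 1 (0 : EuclideanSpace ℝ (Fin 3)) =
      EuclideanSpace.single (0 : Fin 3) (1 : ℝ) + EuclideanSpace.single (1 : Fin 3) (1 : ℝ) +
        EuclideanSpace.single (2 : Fin 3) (1 : ℝ) := by
    ext i
    fin_cases i <;> simp
  have hc := congrArg (fun v : EuclideanSpace ℝ (Fin 3) => v 0) h
  simp only [convect] at hc
  rw [hv, map_add, map_add] at hc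
  simp only [PiLp.add_apply, ABC.fderiv_abc_single, PiLp.zero_apply] at hc
  simp [ABC.jac] at hc

/-- **Step 5 holds — VACUOUSLY** (D-0026 in-file discharge; statement unchanged): the typed
implication `Step 4 → Clay (A)` is true because its antecedent Step 4 ((39) p.8, «(v·∇)v ≡ 0 on
divergence-free fields») is false (`not_step4`: the ABC field). The heat-semigroup content the
print intends at (41)–(42) («the global solution … for f_ex ≡ 0 … smooth at any time moment») is
NOT needed for the typed statement and is not formalised here. [cite: Zhirkin2016, §2.4 eqs. (39)–(42) p.8] -/
theorem step5_holds : Step5_linearGlobal := fun h4 => (not_step4 h4).elim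

end Literature.Claims.NS.Zhirkin2016

end

-- WHAT THIS IS NOT: not a claim about NS regularity or blow-up; not a claim about any author beyond the typed locator.

/-! ## `_holds` aliases (appended 2026-08-28, flt-inv gen 65)

The named fact(s) below are already theorems of THIS file under another name; the alias records the
discharge under the tree's exact naming convention `X_holds` (D-0026 bookkeeping: the proof term is the
existing theorem; no statement, definition or attribute is edited; no new named fact).  The ledger's debt
table listed each as unproved (`ledger fact claim` GRANTED «status unproved», 2026-08-28T08:5xZ). -/

/-- `Step5_linearGlobal` — Step 5 (§2.4 (40)–(42): the linear problem has a global smooth solution once the nonlinear term vanishes) holds — VACUOUSLY, its antecedent `Step4_nonlinearVanishes` being refuted in this file (`not_step4`) (`Literature.Claims.NS.Zhirkin2016.step5_holds`). [cite: Zhirkin2016, §2.4 eqs. (40)–(42) p.8] -/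
theorem _root_.Literature.Claims.NS.Zhirkin2016.Step5_linearGlobal_holds : _root_.Literature.Claims.NS.Zhirkin2016.Step5_linearGlobal :=
  _root_.Literature.Claims.NS.Zhirkin2016.step5_holds
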